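import Summits.AtomisticToContinuum.HydrodynamicLimit.Theorems.KickIsotropyInfo.Negative.KickIsotropyInfoFalseOfShieldingBiasPersists
import Literature.Analysis.FluidPDE.HardSphereUniqueness

/-!
# The flow quantifier of `KickIsotropyInfo` is not load-bearing (orbit congruence)

Negative-side structure for the crux `InformationPercolationEngine.KickIsotropyInfo`
(stmt-AtomisticToContinuum-13478), companion of `Negative/KickIsotropyInfoFalseOfShieldingBiasPersists.lean`:

* ORBIT CONGRUENCE (generic hard-sphere flows): the `n`-th collision time / partner / record / coarse past of
  a particle and its collision times in `(0, τ]` depend on the flow ONLY through the forward orbit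
  `s ↦ Φ_s z`, `s ≥ 0` (`nthCollisionTimeOf_congr`, `nthPartnerOf_congr`, `nthRecordOf_congr`,
  `coarsePastOf_congr`, `collisionTimesOf_inter_Ioc_congr`; all enumerated times are `≥ 0`), and two flows
  agree forward on their common good set (`flow_eq_of_mem_good`, forward uniqueness
  `IsHardSphereTrajectory.unique_holds`);
* hence the crux's kick sum is flow-independent almost surely under every local Gibbs law (`kickSum_ae_eq`;
  local Gibbs laws are `≪` Liouville, which charges no bad set), `KickBound` is flow-independent
  (`kickBound_iff_of_flows`), and
* `kickIsotropyInfo_iff_exists_flow` — **the crux is equivalent to its version with `∀ Φ` replaced by `∃ Φ`**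
  (flow families exist below `σ = 1/2`, `nonempty_flow`): provers may fix ANY convenient flow family (e.g.
  Alexander's explicit construction `Alexander.torusFlow`), and a bias exhibited for ONE flow family is a bias
  for all (`shieldingBiasPersists_iff_forall_flow`: `H` with `∃ Φ` ⇔ `H` with `∀ Φ`).
No statement of the route is asserted here, positively or negatively.
refuter-cdisprove-stmt-AtomisticToContinuum-13478-g2-0.

DEPENDENCY-DRIFT REPAIR (2026-08-17, full-build breakage; no statement changed): route InformationPercolationEngine
replaced the absolute crux `KickIsotropyInfo` (stmt-AtomisticToContinuum-13478 → stmt-14914, rev 5, 2026-08-16) and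
its route file no longer declares the constant; the companion file
`Negative/KickIsotropyInfoFalseOfShieldingBiasPersists.lean` re-homed it VERBATIM as
`Summit.AtomisticToContinuum.HydrodynamicLimit.Theorems.KickIsotropyInfoNegative.KickIsotropyInfo` (gate maintenance,
2026-08-16), which is the constant `KickIsotropyInfo` / `kickIsotropyInfo_iff` below now denote — the former
`open …Theses.InformationPercolationEngine (KickIsotropyInfo)` line is gone, nothing else moved.
-/

open MeasureTheory Metric Real Set Filter
open scoped InnerProductSpace ENNReal BigOperators

namespace Summit.AtomisticToContinuum.HydrodynamicLimit.Theorems.KickIsotropyInfoNegative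

noncomputable section

open Literature.MathematicalPhysics.KineticTheory (T3 V3 hsDiameter localGibbsLaw)
open Literature.Analysis.FluidPDE (HardSphereFlow Config collisionTimesOf flightStart)
-- `KickIsotropyInfo` below is `KickIsotropyInfoNegative.KickIsotropyInfo`, the verbatim re-homing (companion file) of
-- the retired route constant `Theses.InformationPercolationEngine.KickIsotropyInfo` (stmt-AtomisticToContinuum-13478).

/-! ## Orbit congruence: every collision functional of the crux depends on the flow only through
the forward orbit, hence (forward uniqueness on the common good set) NOT on the choice of the flow -/

section Orbit

open Literature.Analysis.FluidPDE

variable {d : Type*} [Fintype d] {X : Type*} {M : ℕ}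

/-- `nextTimeAfter S x ≥ 0` for `x ≥ 0` (the set `S ∩ (x, ∞)` is bounded below by `0`; `sInf ∅ = 0`).
[folklore] -/
theorem nextTimeAfter_nonneg (S : Set ℝ) {x : ℝ} (hx : 0 ≤ x) : 0 ≤ nextTimeAfter S x :=
  Real.sInf_nonneg fun _ ht => hx.trans (le_of_lt ht.2)

/-- `nextTimeAfter S x` only depends on the positive part of `S` (for `x ≥ 0`). [folklore] -/
theorem nextTimeAfter_congr {S S' : Set ℝ} (h : ∀ t, 0 < t → (t ∈ S ↔ t ∈ S')) {x : ℝ}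
    (hx : 0 ≤ x) : nextTimeAfter S x = nextTimeAfter S' x := by
  unfold nextTimeAfter
  congr 1
  ext t
  simp only [mem_inter_iff, mem_Ioi]
  constructor
  · rintro ⟨ht, hxt⟩
    exact ⟨(h t (hx.trans_lt hxt)).1 ht, hxt⟩
  · rintro ⟨ht, hxt⟩
    exact ⟨(h t (hx.trans_lt hxt)).2 ht, hxt⟩

/-- The enumeration from `0` stays nonnegative. [folklore] -/
theorem nthTimeAfter_zero_nonneg (S : Set ℝ) (n : ℕ) : 0 ≤ nthTimeAfter S 0 n := by
  induction n with
  | zero => exact nextTimeAfter_nonneg S le_rfl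
  | succ n ih => rw [nthTimeAfter_succ]; exact nextTimeAfter_nonneg S ih

/-- The enumeration from `0` only depends on the positive part of the set. [folklore] -/
theorem nthTimeAfter_zero_congr {S S' : Set ℝ} (h : ∀ t, 0 < t → (t ∈ S ↔ t ∈ S')) (n : ℕ) :
    nthTimeAfter S 0 n = nthTimeAfter S' 0 n := by
  induction n with
  | zero => simpa only [nthTimeAfter_zero] using nextTimeAfter_congr h le_rfl
  | succ n ih =>
    rw [nthTimeAfter_succ, nthTimeAfter_succ, ih]
    exact nextTimeAfter_congr h (nthTimeAfter_zero_nonneg S' n)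

variable (G : Geometry d X) (ε : ℝ)

/-- The flight start from time `0` is nonnegative. [folklore] -/
theorem flightStart_zero_nonneg (γ : ℝ → Config M d X) (k : Fin M) (t : ℝ) :
    0 ≤ flightStart G ε γ 0 k t :=
  Real.sSup_nonneg' ⟨0, mem_insert _ _, le_rfl⟩

/-- The flight start from time `0` only depends on the curve at positive times. [folklore] -/
theorem flightStart_zero_congr {γ γ' : ℝ → Config M d X} (h : ∀ s, 0 < s → γ s = γ' s)
    (k : Fin M) (t : ℝ) : flightStart G ε γ 0 k t = flightStart G ε γ' 0 k t := by
  unfold flightStart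
  congr 1
  ext s
  simp only [mem_insert_iff, mem_inter_iff, mem_Ioo, mem_collisionTimesOf]
  constructor
  · rintro (hs | ⟨hp, hs0, hst⟩)
    · exact Or.inl hs
    · exact Or.inr ⟨by rwa [← h s hs0], hs0, hst⟩
  · rintro (hs | ⟨hp, hs0, hst⟩)
    · exact Or.inl hs
    · exact Or.inr ⟨by rwa [h s hs0], hs0, hst⟩

/-- The collision times of a particle in `(0, τ]` only depend on the curve at positive times.
[folklore] -/
theorem collisionTimesOf_inter_Ioc_congr {γ γ' : ℝ → Config M d X} (h : ∀ s, 0 < s → γ s = γ' s)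
    (k : Fin M) (τ : ℝ) :
    collisionTimesOf G ε γ k ∩ Ioc 0 τ = collisionTimesOf G ε γ' k ∩ Ioc 0 τ := by
  ext t
  simp only [mem_inter_iff, mem_Ioc, mem_collisionTimesOf]
  constructor
  · rintro ⟨hp, ht0, htτ⟩
    exact ⟨by rwa [← h t ht0], ht0, htτ⟩
  · rintro ⟨hp, ht0, htτ⟩
    exact ⟨by rwa [h t ht0], ht0, htτ⟩

variable {G ε} [MeasureSpace X] [TopologicalSpace X] {Φ Ψ : HardSphereFlow G ε M}
  {z : Config M d X}

/-- The `n`-th collision time of `i` (from `0`) is nonnegative. [folklore] -/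
theorem nthCollisionTimeOf_nonneg (Φ : HardSphereFlow G ε M) (i : Fin M) (n : ℕ) (z : Config M d X) :
    0 ≤ Φ.nthCollisionTimeOf i n z :=
  nthTimeAfter_zero_nonneg _ n

/-- Two flows whose forward orbits from `z` agree have the same collision times of `i`. [folklore] -/
theorem nthCollisionTimeOf_congr (h : ∀ s, 0 ≤ s → Φ.flow s z = Ψ.flow s z) (i : Fin M) (n : ℕ) :
    Φ.nthCollisionTimeOf i n z = Ψ.nthCollisionTimeOf i n z :=
  nthTimeAfter_zero_congr (fun t ht => by simp only [mem_collisionTimesOf, h t ht.le]) n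

/-- … the same partners. [folklore] -/
theorem nthPartnerOf_congr (h : ∀ s, 0 ≤ s → Φ.flow s z = Ψ.flow s z) (i : Fin M) (n : ℕ) :
    Φ.nthPartnerOf i n z = Ψ.nthPartnerOf i n z := by
  unfold HardSphereFlow.nthPartnerOf
  rw [nthCollisionTimeOf_congr h, h _ (nthCollisionTimeOf_nonneg Ψ i n z)]

/-- … the same collision records. [folklore] -/
theorem nthRecordOf_congr (h : ∀ s, 0 ≤ s → Φ.flow s z = Ψ.flow s z) (i : Fin M) (n : ℕ) :
    Φ.nthRecordOf i n z = Ψ.nthRecordOf i n z := by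
  unfold HardSphereFlow.nthRecordOf
  rw [nthPartnerOf_congr h, nthCollisionTimeOf_congr h, h _ (nthCollisionTimeOf_nonneg Ψ i n z)]

/-- … and the same coarse pasts. [folklore] -/
theorem coarsePastOf_congr {C : Type*} (h : ∀ s, 0 ≤ s → Φ.flow s z = Ψ.flow s z) (q : X → C)
    (i : Fin M) (n : ℕ) : Φ.coarsePastOf q i n z = Ψ.coarsePastOf q i n z := by
  unfold HardSphereFlow.coarsePastOf
  have h' : ∀ s, 0 < s → Φ.flow s z = Ψ.flow s z := fun s hs => h s hs.le
  rw [nthPartnerOf_congr h, nthCollisionTimeOf_congr h, flightStart_zero_congr G ε h',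
    flightStart_zero_congr G ε h' (Ψ.nthPartnerOf i n z), h _ (flightStart_zero_nonneg G ε _ _ _),
    h _ (flightStart_zero_nonneg G ε _ _ _)]

/-- **Forward agreement on the common good set** (forward uniqueness of hard-sphere trajectories,
`IsHardSphereTrajectory.unique_holds`). [folklore] -/
theorem flow_eq_of_mem_good [T2Space X] (hΦ : z ∈ Φ.good) (hΨ : z ∈ Ψ.good) :
    ∀ s, 0 ≤ s → Φ.flow s z = Ψ.flow s z := by
  intro s hs
  have h0 : Φ.flow 0 z = Ψ.flow 0 z := by rw [Φ.flow_zero z hΦ, Ψ.flow_zero z hΨ]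
  exact IsHardSphereTrajectory.unique_holds (Φ.isTrajectory z hΦ) (Ψ.isTrajectory z hΨ) h0
    (Set.mem_Ici.2 hs)

end Orbit

/-! ## The flow quantifier of the crux is not load-bearing -/

section FlowIndep

variable {σ : ℝ} {N : ℕ}

/-- The kick sum depends on the flow only through the forward orbit. [folklore] -/
theorem kickSum_congr {Φ Ψ : Flow σ N} {z : Config (N + 1) (Fin 3) T3}
    (h : ∀ s, 0 ≤ s → Φ.flow s z = Ψ.flow s z) (τ r : ℝ) (g : V3 × V3 × V3 → ℝ)
    (hh : Fin (N + 1) → ℕ → Past N → ℝ) : kickSum σ N Φ τ r g hh z = kickSum σ N Ψ τ r g hh z := by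
  unfold kickSum
  have h' : ∀ s, 0 < s → Φ.flow s z = Ψ.flow s z := fun s hs => h s hs.le
  simp only [collisionTimesOf_inter_Ioc_congr _ _ h', nthRecordOf_congr h, coarsePastOf_congr h,
    nthPartnerOf_congr h]

/-- The local Gibbs law does not depend on the flow argument (it only fixes the phase space). -/
theorem localGibbsLaw_flow_irrel (a₀ θ₀ : T3 → ℝ) (u₀ : T3 → V3) (Φ Ψ : Flow σ N) :
    localGibbsLaw σ a₀ u₀ θ₀ N Φ = localGibbsLaw σ a₀ u₀ θ₀ N Ψ := rfl

/-- Local Gibbs laws do not charge the complement of the good set of ANY flow. [folklore] -/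
theorem ae_mem_good_localGibbsLaw (a₀ θ₀ : T3 → ℝ) (u₀ : T3 → V3) (Φ Ψ : Flow σ N) :
    ∀ᵐ z ∂(localGibbsLaw σ a₀ u₀ θ₀ N Φ), z ∈ Ψ.good := by
  have hL : localGibbsLaw σ a₀ u₀ θ₀ N Φ =
      (Literature.Analysis.FluidPDE.liouville (Literature.Analysis.FluidPDE.Torus.geometry (Fin 3)) (N + 1)
        (hsDiameter σ N)).withDensity fun z => ENNReal.ofReal
        (Literature.Analysis.FluidPDE.canonicalDensity (Literature.Analysis.FluidPDE.Torus.geometry (Fin 3))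
          (hsDiameter σ N) (N + 1) (Literature.MathematicalPhysics.KineticTheory.localGibbsProfile a₀ u₀ θ₀) z) :=
    rfl
  rw [hL]
  exact (withDensity_absolutelyContinuous _ _).ae_le Ψ.ae_mem_good

/-- **The kick sums of two flows agree almost surely** under every local Gibbs law. [folklore] -/
theorem kickSum_ae_eq (a₀ θ₀ : T3 → ℝ) (u₀ : T3 → V3) (Φ Ψ : Flow σ N) (τ r : ℝ)
    (g : V3 × V3 × V3 → ℝ) (hh : Fin (N + 1) → ℕ → Past N → ℝ) :
    kickSum σ N Φ τ r g hh =ᵐ[localGibbsLaw σ a₀ u₀ θ₀ N Φ] kickSum σ N Ψ τ r g hh := by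
  filter_upwards [ae_mem_good_localGibbsLaw a₀ θ₀ u₀ Φ Φ, ae_mem_good_localGibbsLaw a₀ θ₀ u₀ Φ Ψ]
    with z hzΦ hzΨ
  exact kickSum_congr (flow_eq_of_mem_good hzΦ hzΨ) τ r g hh

/-- **`KickBound` does not depend on the choice of the flow.** [folklore] -/
theorem kickBound_iff_of_flows (a₀ θ₀ : T3 → ℝ) (u₀ : T3 → V3) (Φ Ψ : Flow σ N) (τ r : ℝ)
    (g : V3 × V3 × V3 → ℝ) (hh : Fin (N + 1) → ℕ → Past N → ℝ) (δ : ℝ) :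
    KickBound σ a₀ θ₀ u₀ N Φ τ r g hh δ ↔ KickBound σ a₀ θ₀ u₀ N Ψ τ r g hh δ := by
  unfold KickBound
  have hae : (fun z => ENNReal.ofReal |kickSum σ N Φ τ r g hh z|) =ᵐ[localGibbsLaw σ a₀ u₀ θ₀ N Φ]
      (fun z => ENNReal.ofReal |kickSum σ N Ψ τ r g hh z|) := by
    filter_upwards [kickSum_ae_eq a₀ θ₀ u₀ Φ Ψ τ r g hh] with z hz
    rw [hz]
  rw [lintegral_congr_ae hae, localGibbsLaw_flow_irrel a₀ θ₀ u₀ Φ Ψ]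

/-- **The flow quantifier of `KickIsotropyInfo` is not load-bearing**: the crux is equivalent to its
version with `∀ Φ` replaced by `∃ Φ` (flow families exist below `σ = 1/2`, `nonempty_flow`, and
`KickBound` is flow-independent, `kickBound_iff_of_flows`). Provers may therefore fix ANY convenient
flow family (e.g. Alexander's explicit construction); the negative side may attack any one. [folklore] -/
theorem kickIsotropyInfo_iff_exists_flow :
    KickIsotropyInfo ↔
      ∀ (a₀ θ₀ : T3 → ℝ) (u₀ : T3 → V3), Continuous a₀ → Continuous θ₀ → Continuous u₀ →
        (∀ x, 0 < a₀ x) → (∀ x, 0 < θ₀ x) → ∃ σ₀ : ℝ, 0 < σ₀ ∧ ∀ σ : ℝ, 0 < σ → σ < σ₀ →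
        ∃ Φ : (N : ℕ) → Flow σ N, ∀ τ : ℝ, 0 < τ → ∀ r : ℝ, 0 < r →
        ∀ g : V3 × V3 × V3 → ℝ, Continuous g → (∃ C : ℝ, ∀ p, |g p| ≤ C) → ZeroFluxMean g →
        ∀ δ : ℝ, 0 < δ → ∃ N₀ : ℕ, ∀ N : ℕ, N₀ ≤ N →
        ∀ h : Fin (N + 1) → ℕ → Past N → ℝ, (∀ i n, Measurable (h i n)) → (∀ i n p, |h i n p| ≤ 1) →
        KickBound σ a₀ θ₀ u₀ N (Φ N) τ r g h δ := by
  rw [kickIsotropyInfo_iff]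
  constructor
  · intro H a₀ θ₀ u₀ ha hθ hu ha0 hθ0
    obtain ⟨σ₀, hσ₀, Hσ⟩ := H a₀ θ₀ u₀ ha hθ hu ha0 hθ0
    refine ⟨min σ₀ 2⁻¹, lt_min hσ₀ (by norm_num), fun σ hσ hσlt => ?_⟩
    obtain ⟨Φ⟩ := nonempty_flow hσ (hσlt.trans_le (min_le_right _ _))
    exact ⟨Φ, Hσ σ hσ (hσlt.trans_le (min_le_left _ _)) Φ⟩
  · intro H a₀ θ₀ u₀ ha hθ hu ha0 hθ0
    obtain ⟨σ₀, hσ₀, Hσ⟩ := H a₀ θ₀ u₀ ha hθ hu ha0 hθ0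
    refine ⟨σ₀, hσ₀, fun σ hσ hσlt Φ τ hτ r hr g hg hgb hg0 δ hδ => ?_⟩
    obtain ⟨Ψ, HΨ⟩ := Hσ σ hσ hσlt
    obtain ⟨N₀, hN₀⟩ := HΨ τ hτ r hr g hg hgb hg0 δ hδ
    exact ⟨N₀, fun N hN h hm hb =>
      (kickBound_iff_of_flows a₀ θ₀ u₀ (Φ N) (Ψ N) τ r g h δ).2 (hN₀ N hN h hm hb)⟩

/-- Likewise `H` with `∃ Φ` is equivalent to `H` with `∀ Φ`: a shielding bias for ONE flow family is
a shielding bias for EVERY flow family. [folklore] -/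
theorem shieldingBiasPersists_iff_forall_flow :
    ShieldingBiasPersists ↔
      ∀ σ₀ : ℝ, 0 < σ₀ → ∃ σ : ℝ, 0 < σ ∧ σ < σ₀ ∧ ∃ τ : ℝ, 0 < τ ∧
        ∃ r : ℝ, 0 < r ∧ ∃ c : V3 → V3 → V3, (Continuous fun p : V3 × V3 => c p.1 p.2) ∧
        (∀ v w, ⟪c v w, w - v⟫_ℝ = 0) ∧ ∃ κ : ℝ, 0 < κ ∧ ∃ K : ℝ, ∃ δ : ℝ, 0 < δ ∧
        (Nonempty ((N : ℕ) → Flow σ N)) ∧ ∀ Φ : (N : ℕ) → Flow σ N,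
        ∀ N₀ : ℕ, ∃ N : ℕ, N₀ ≤ N ∧
          ¬ KickBound σ (fun _ => 1) (fun _ => 1) (fun _ => 0) N (Φ N) τ r (kickTest c κ)
            (shieldWeight c K N) δ := by
  constructor
  · intro H σ₀ hσ₀
    obtain ⟨σ, hσ, hσσ₀, Φ, τ, hτ, r, hr, c, hc, hcb, κ, hκ, K, δ, hδ, hN⟩ := H σ₀ hσ₀
    refine ⟨σ, hσ, hσσ₀, τ, hτ, r, hr, c, hc, hcb, κ, hκ, K, δ, hδ, ⟨Φ⟩, fun Ψ N₀ => ?_⟩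
    obtain ⟨N, hle, hnot⟩ := hN N₀
    exact ⟨N, hle, fun hb => hnot ((kickBound_iff_of_flows _ _ _ (Ψ N) (Φ N) τ r _ _ δ).1 hb)⟩
  · intro H σ₀ hσ₀
    obtain ⟨σ, hσ, hσσ₀, τ, hτ, r, hr, c, hc, hcb, κ, hκ, K, δ, hδ, ⟨Φ⟩, hall⟩ := H σ₀ hσ₀
    exact ⟨σ, hσ, hσσ₀, Φ, τ, hτ, r, hr, c, hc, hcb, κ, hκ, K, δ, hδ, hall Φ⟩

end FlowIndep

end

end Summit.AtomisticToContinuum.HydrodynamicLimit.Theorems.KickIsotropyInfoNegative
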